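import Mathlib
import Literature.Analysis.FluidPDE.BoltzmannEquation
import HarnessLib

/-!
# Scaling covariance of the hard-sphere entropy production

Rezakhanlou–Villani, *Entropy Methods for the Boltzmann Equation*, LNM 1916 (2008), Ch. 1 §1.4.2,
"Normalization", pp. 23–24: if a velocity density `f` on `ℝ^N` is written
`f(v) = ρ T^{-N/2} f̃((v - u)/√T)` then the entropy production transforms as `D(f) = ρ² D̃(f̃)`, where
`D̃` is the entropy production of the rescaled kernel `B̃(z, σ) = B(√T z, σ)`; for the hard-sphere
kernel `B = |z|` (homogeneous of degree one) this reads `D(f) = ρ² √T · D(f̃)`.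

This file proves the `ρ = 1` identity in the tree's conventions
(`Literature.Analysis.FluidPDE.entropyProduction` with the `ω`-representation kernel
`Literature.MathematicalPhysics.KineticTheory.hardSphereKernel = ((v - v_*)·ω)₊` on a finite-dimensional
real inner-product space `E`, `d = dim E`): for every `a > 0`, `u ∈ E` and every `f : E → ℝ`,

`D(f) = a · D(x ↦ a^d f(u + a x))` (`entropyProduction_hardSphereKernel_affine`).

No integrability or positivity hypothesis is needed: the change of variables
`(v, v_*, ω) ↦ (u + a v, u + a v_*, ω)` is a measurable equivalence of `E × E × S^{d-1}` which maps
the reference measure `(dv dv_*) dω` to `a^{-2d}` times itself, and Bochner integrals (junk value `0`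
included) are covariant under measurable equivalences.

These are Stage 0 (normalisation to the class `𝒞(1,0,1)`) lemmas for the entropy–entropy-production
inequality `Literature.MathematicalPhysics.KineticTheory.HardSphereEEP`.
-/

namespace Literature.MathematicalPhysics.KineticTheory

open _root_.MeasureTheory _root_.MeasureTheory.Measure Real Metric
open scoped InnerProductSpace ENNReal

noncomputable section

variable {E : Type*} [NormedAddCommGroup E] [InnerProductSpace ℝ E]

/-- The elastic collision law commutes with affine maps `v ↦ u + a v` of velocity space applied to
both particles (Galilean invariance and homogeneity of `collide`). [folklore] -/
theorem collide_affine (ω : sphere (0 : E) 1) (u : E) (a : ℝ) (p : E × E) :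
    collide ω (u + a • p.1, u + a • p.2) =
      (u + a • (collide ω p).1, u + a • (collide ω p).2) := by
  obtain ⟨v, w⟩ := p
  have hsub : u + a • v - (u + a • w) = a • (v - w) := by
    rw [smul_sub]; abel
  simp only [collide, hsub, inner_smul_left, RCLike.conj_to_real, Prod.mk.injEq]
  constructor
  · rw [smul_sub, smul_smul]
    abel
  · rw [smul_add, smul_smul]
    abel

/-- The hard-sphere kernel is homogeneous of degree one and translation invariant:
`((u + a v) - (u + a v_*))·ω)₊ = a ((v - v_*)·ω)₊` for `a ≥ 0`. [folklore] -/
theorem hardSphereKernel_affine (ω : sphere (0 : E) 1) (u : E) {a : ℝ} (ha : 0 ≤ a) (p : E × E) :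
    hardSphereKernel (u + a • p.1, u + a • p.2) ω = a * hardSphereKernel p ω := by
  have hsub : u + a • p.1 - (u + a • p.2) = a • (p.1 - p.2) := by
    rw [smul_sub]; abel
  simp only [hardSphereKernel, hsub, inner_smul_left, RCLike.conj_to_real]
  rw [mul_max_of_nonneg _ _ ha, mul_zero]

/-- Affine change of variables in a local Maxwellian: for `a > 0`,
`M_{ρ,c,θ}(u + a x) = a^{-d} M_{ρ,(c-u)/a,θ/a²}(x)` (`d = dim E`). For `c = u`, `θ = a² θ₀` this is the
normalisation `M_{ρ,u,Tθ₀}(u + √T x) = T^{-d/2} M_{ρ,0,θ₀}(x)` of Rezakhanlou–Villani 2008, p. 23.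
[folklore] -/
theorem localMaxwellian_affine (ρ : ℝ) {θ : ℝ} (hθ : 0 ≤ θ) (c u : E) {a : ℝ} (ha : 0 < a) (x : E) :
    Literature.Analysis.FluidPDE.localMaxwellian ρ θ c (u + a • x) =
      (a ^ Module.finrank ℝ E)⁻¹ *
        Literature.Analysis.FluidPDE.localMaxwellian ρ (θ / a ^ 2) (a⁻¹ • (c - u)) x := by
  unfold Literature.Analysis.FluidPDE.localMaxwellian
  set d : ℕ := Module.finrank ℝ E with hd
  have hvec : u + a • x - c = a • (x - a⁻¹ • (c - u)) := by
    rw [smul_sub, smul_smul, mul_inv_cancel₀ ha.ne', one_smul]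
    abel
  have hnorm : -‖u + a • x - c‖ ^ 2 / (2 * θ) = -‖x - a⁻¹ • (c - u)‖ ^ 2 / (2 * (θ / a ^ 2)) := by
    rw [hvec, norm_smul, mul_pow, Real.norm_eq_abs, sq_abs]
    rcases eq_or_lt_of_le hθ with h0 | hpos
    · simp [← h0]
    · field_simp
  have hpre : (2 * π * (θ / a ^ 2)) ^ (-(d : ℝ) / 2) = a ^ d * (2 * π * θ) ^ (-(d : ℝ) / 2) := by
    rw [show 2 * π * (θ / a ^ 2) = (a ^ 2)⁻¹ * (2 * π * θ) by field_simp,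
      Real.mul_rpow (by positivity) (by positivity)]
    congr 1
    rw [neg_div, Real.inv_rpow (by positivity), Real.rpow_neg (by positivity), inv_inv,
      show (a ^ 2 : ℝ) = a ^ (2 : ℝ) by norm_cast, ← Real.rpow_mul ha.le,
      show (2 : ℝ) * ((d : ℝ) / 2) = (d : ℝ) by ring, Real.rpow_natCast]
  rw [hnorm, hpre]
  have had : (a ^ d : ℝ) ≠ 0 := pow_ne_zero _ ha.ne'
  field_simp

/-- **Normalisation of a regularised velocity cloud.** For weights `p_i`, centres `v_i`, `0 ≤ T`,
`0 < a` and any `u`, the rescaled cloud `x ↦ a^d f̂(u + a x)` of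
`f̂ = (1 - δ) Σ p_i M_{1,v_i,h²} + δ M_{1,u,T}` is again a cloud, with centres `(v_i - u)/a`,
width `h/a` and Maxwellian part `M_{1,0,T/a²}` (for `a = √T`: the standard Maxwellian `M_{1,0,1}`)
(Rezakhanlou–Villani 2008, Ch. 1 §1.4.2 "Normalization", p. 23, applied to Gaussian mixtures).
[folklore] -/
theorem cloud_affine {n : ℕ} (p : Fin n → ℝ) (v : Fin n → E) (u : E) (δ h : ℝ) {T a : ℝ}
    (hT : 0 ≤ T) (ha : 0 < a) (x : E) :
    a ^ Module.finrank ℝ E *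
        ((1 - δ) * ∑ i, p i * Literature.Analysis.FluidPDE.localMaxwellian 1 (h ^ 2) (v i) (u + a • x) +
          δ * Literature.Analysis.FluidPDE.localMaxwellian 1 T u (u + a • x)) =
      (1 - δ) * ∑ i, p i *
          Literature.Analysis.FluidPDE.localMaxwellian 1 ((h / a) ^ 2) (a⁻¹ • (v i - u)) x +
        δ * Literature.Analysis.FluidPDE.localMaxwellian 1 (T / a ^ 2) 0 x := by
  set d : ℕ := Module.finrank ℝ E with hd
  have had : (a ^ d : ℝ) ≠ 0 := pow_ne_zero _ ha.ne'
  have hM : Literature.Analysis.FluidPDE.localMaxwellian 1 T u (u + a • x) =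
      (a ^ d)⁻¹ * Literature.Analysis.FluidPDE.localMaxwellian 1 (T / a ^ 2) 0 x := by
    rw [localMaxwellian_affine 1 hT u u ha x, sub_self, smul_zero]
  have hG : ∀ i, Literature.Analysis.FluidPDE.localMaxwellian 1 (h ^ 2) (v i) (u + a • x) =
      (a ^ d)⁻¹ * Literature.Analysis.FluidPDE.localMaxwellian 1 ((h / a) ^ 2) (a⁻¹ • (v i - u)) x := by
    intro i
    rw [localMaxwellian_affine 1 (sq_nonneg h) (v i) u ha x, div_pow]
  simp_rw [hM, hG]
  rw [mul_add, Finset.mul_sum, Finset.mul_sum, Finset.mul_sum]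
  congr 1
  · refine Finset.sum_congr rfl fun i _ => ?_
    field_simp
  · field_simp

variable [FiniteDimensional ℝ E] [MeasurableSpace E] [BorelSpace E]

/-- Change of variables `(q, ω) ↦ ((u, u) + a • q, ω)` in an integral over `E × E × S^{d-1}` against
`(dv dv_*) dω`: the integral gets multiplied by `|a^{-2d}|`. Holds for every integrand (Bochner
convention `∫ = 0` for non-integrable functions is preserved by measurable equivalences). [folklore] -/
theorem integral_comp_affine_prod_sphereMeasure (G : (E × E) × sphere (0 : E) 1 → ℝ) (u : E)
    {a : ℝ} (ha : a ≠ 0) :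
    ∫ x, G ((u, u) + a • x.1, x.2) ∂((volume.prod volume).prod sphereMeasure) =
      |(a ^ (2 * Module.finrank ℝ E))⁻¹| *
        ∫ x, G x ∂(((volume : Measure E).prod volume).prod sphereMeasure) := by
  haveI : IsFiniteMeasure (sphereMeasure (E := E)) := by
    unfold sphereMeasure; infer_instance
  set μ2 : Measure (E × E) := (volume : Measure E).prod volume with hμ2
  let Φ : (E × E) ≃ᵐ (E × E) := (MeasurableEquiv.smul₀ a ha).trans (MeasurableEquiv.addLeft (u, u))
  let Θ : ((E × E) × sphere (0 : E) 1) ≃ᵐ ((E × E) × sphere (0 : E) 1) :=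
    MeasurableEquiv.prodCongr Φ (MeasurableEquiv.refl _)
  have hΦ : (Φ : E × E → E × E) = (fun q => (u, u) + q) ∘ fun q => a • q := rfl
  have hΘ : (Θ : (E × E) × sphere (0 : E) 1 → (E × E) × sphere (0 : E) 1) = Prod.map Φ id := rfl
  have h1 : Measure.map Φ μ2 = ENNReal.ofReal |(a ^ (2 * Module.finrank ℝ E))⁻¹| • μ2 := by
    rw [hΦ, ← Measure.map_map (measurable_const_add _) (measurable_const_smul _),
      Measure.map_addHaar_smul μ2 ha, Measure.map_smul, map_add_left_eq_self, Module.finrank_prod,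
      two_mul]
  have hmap : Measure.map Θ (μ2.prod sphereMeasure) =
      ENNReal.ofReal |(a ^ (2 * Module.finrank ℝ E))⁻¹| • μ2.prod sphereMeasure := by
    rw [hΘ, ← Measure.map_prod_map μ2 sphereMeasure Φ.measurable measurable_id, h1, Measure.map_id,
      Measure.prod_smul_left]
  have hΘx : ∀ x : (E × E) × sphere (0 : E) 1, Θ x = ((u, u) + a • x.1, x.2) := fun x => rfl
  calc ∫ x, G ((u, u) + a • x.1, x.2) ∂(μ2.prod sphereMeasure)
      = ∫ x, G (Θ x) ∂(μ2.prod sphereMeasure) := by simp_rw [hΘx]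
    _ = ∫ x, G x ∂(Measure.map Θ (μ2.prod sphereMeasure)) := (integral_map_equiv Θ G).symm
    _ = |(a ^ (2 * Module.finrank ℝ E))⁻¹| * ∫ x, G x ∂(μ2.prod sphereMeasure) := by
        rw [hmap, integral_smul_measure, ENNReal.toReal_ofReal (abs_nonneg _), smul_eq_mul]

/-- **Scaling covariance of the relative entropy** (Rezakhanlou–Villani 2008, Ch. 1 §1.4.2
"Normalization", p. 24, `H(f | M^f) = ρ H(f̃ | M)`, case `ρ = 1`): for `a > 0`, `θ ≥ 0`, `u ∈ E` and
any `f : E → ℝ`, with `f̃(x) = a^d f(u + a x)`,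
`∫ f̃ log (f̃ / M_{1,0,θ}) = ∫ f log (f / M_{1,u,a²θ})`. No integrability hypothesis (both sides are
junk `0` together). [cite: RezakhanlouVillani2008, Ch. 1 §1.4.2 p. 24] -/
theorem integral_mul_log_div_localMaxwellian_affine (f : E → ℝ) {θ : ℝ} (hθ : 0 ≤ θ) (u : E)
    {a : ℝ} (ha : 0 < a) :
    ∫ x, a ^ Module.finrank ℝ E * f (u + a • x) *
        log (a ^ Module.finrank ℝ E * f (u + a • x) /
          Literature.Analysis.FluidPDE.localMaxwellian 1 θ 0 x) =
      ∫ w, f w * log (f w / Literature.Analysis.FluidPDE.localMaxwellian 1 (a ^ 2 * θ) u w) := by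
  set d : ℕ := Module.finrank ℝ E with hd
  have had : (a ^ d : ℝ) ≠ 0 := pow_ne_zero _ ha.ne'
  set G : E → ℝ := fun w =>
    f w * log (f w / Literature.Analysis.FluidPDE.localMaxwellian 1 (a ^ 2 * θ) u w) with hG
  have hM : ∀ x, Literature.Analysis.FluidPDE.localMaxwellian 1 (a ^ 2 * θ) u (u + a • x) =
      (a ^ d)⁻¹ * Literature.Analysis.FluidPDE.localMaxwellian 1 θ 0 x := by
    intro x
    rw [localMaxwellian_affine 1 (by positivity) u u ha x, sub_self, smul_zero,
      mul_div_cancel_left₀ _ (pow_ne_zero 2 ha.ne')]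
  have hLHS : ∀ x, a ^ d * f (u + a • x) *
      log (a ^ d * f (u + a • x) / Literature.Analysis.FluidPDE.localMaxwellian 1 θ 0 x) =
      a ^ d * G (u + a • x) := by
    intro x
    simp only [hG, hM x, mul_assoc]
    congr 3
    field_simp
  simp_rw [hLHS]
  rw [integral_const_mul,
    show (fun x => G (u + a • x)) = fun x => (fun y => G (u + y)) (a • x) from rfl,
    Measure.integral_comp_smul volume (fun y => G (u + y)) a, integral_add_left_eq_self,
    abs_of_pos (by positivity), smul_eq_mul, ← mul_assoc, mul_inv_cancel₀ had, one_mul]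

/-- **Scaling covariance of the hard-sphere entropy production** (Rezakhanlou–Villani 2008, Ch. 1
§1.4.2 "Normalization", pp. 23–24, case `ρ = 1`, `B = |z|`): for `a > 0`, `u ∈ E` and any velocity
density `f` on `E` (`d = dim E`), with `f̃(x) = a^d f(u + a x)`,
`D(f) = a · D(f̃)`. In the book's notation `a = √T`, so `D(f) = √T D(f̃)`.
[cite: RezakhanlouVillani2008, Ch. 1 §1.4.2 pp. 23–24] -/
theorem entropyProduction_hardSphereKernel_affine (f : E → ℝ) (u : E) {a : ℝ} (ha : 0 < a) :
    Literature.Analysis.FluidPDE.entropyProduction hardSphereKernel f =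
      a * Literature.Analysis.FluidPDE.entropyProduction hardSphereKernel
        (fun x => a ^ Module.finrank ℝ E * f (u + a • x)) := by
  set d : ℕ := Module.finrank ℝ E with hd
  -- the integrand of `D(f)`
  set I : (E × E) × sphere (0 : E) 1 → ℝ := fun q =>
    hardSphereKernel q.1 q.2 *
      ((f (collide q.2 q.1).1 * f (collide q.2 q.1).2 - f q.1.1 * f q.1.2) *
        log (f (collide q.2 q.1).1 * f (collide q.2 q.1).2 / (f q.1.1 * f q.1.2))) with hI
  have had : (0 : ℝ) < a ^ d := pow_pos ha d
  have h2d : (a ^ d * (a ^ d)) ≠ 0 := by positivity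
  -- the integrand of `D(f̃)` is `a^{2d} a⁻¹ · I ∘ Θ`
  have hint : ∀ q : (E × E) × sphere (0 : E) 1,
      hardSphereKernel q.1 q.2 *
        ((a ^ d * f (u + a • (collide q.2 q.1).1) * (a ^ d * f (u + a • (collide q.2 q.1).2)) -
            a ^ d * f (u + a • q.1.1) * (a ^ d * f (u + a • q.1.2))) *
          log (a ^ d * f (u + a • (collide q.2 q.1).1) * (a ^ d * f (u + a • (collide q.2 q.1).2)) /
            (a ^ d * f (u + a • q.1.1) * (a ^ d * f (u + a • q.1.2))))) =
        a ^ d * a ^ d * a⁻¹ * I ((u, u) + a • q.1, q.2) := by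
    intro q
    obtain ⟨⟨v, w⟩, ω⟩ := q
    have hc := collide_affine ω u a (v, w)
    have hk := hardSphereKernel_affine ω u ha.le (v, w)
    simp only at hc hk
    simp only [hI, Prod.smul_mk, Prod.mk_add_mk, hc, hk]
    have hlog : a ^ d * f (u + a • (collide ω (v, w)).1) * (a ^ d * f (u + a • (collide ω (v, w)).2)) /
        (a ^ d * f (u + a • v) * (a ^ d * f (u + a • w))) =
        f (u + a • (collide ω (v, w)).1) * f (u + a • (collide ω (v, w)).2) /
          (f (u + a • v) * f (u + a • w)) := by
      rw [show a ^ d * f (u + a • (collide ω (v, w)).1) * (a ^ d * f (u + a • (collide ω (v, w)).2)) =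
          a ^ d * a ^ d * (f (u + a • (collide ω (v, w)).1) * f (u + a • (collide ω (v, w)).2)) by ring,
        show a ^ d * f (u + a • v) * (a ^ d * f (u + a • w)) =
          a ^ d * a ^ d * (f (u + a • v) * f (u + a • w)) by ring,
        mul_div_mul_left _ _ h2d]
    rw [hlog]
    field_simp
  set μ3 : Measure ((E × E) × sphere (0 : E) 1) :=
    ((volume : Measure E).prod volume).prod sphereMeasure with hμ3
  have hL : Literature.Analysis.FluidPDE.entropyProduction hardSphereKernel f =
      4⁻¹ * ∫ x, I x ∂μ3 := rfl
  have hR : Literature.Analysis.FluidPDE.entropyProduction hardSphereKernel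
      (fun x => a ^ d * f (u + a • x)) =
      4⁻¹ * ∫ q, a ^ d * a ^ d * a⁻¹ * I ((u, u) + a • q.1, q.2) ∂μ3 := by
    unfold Literature.Analysis.FluidPDE.entropyProduction
    rw [hμ3]
    congr 1
    refine integral_congr_ae (Filter.Eventually.of_forall fun q => ?_)
    exact hint q
  have ha0 : a ≠ 0 := ha.ne'
  rw [hL, hR, integral_const_mul, hμ3, integral_comp_affine_prod_sphereMeasure I u ha0,
    abs_of_pos (by positivity), pow_mul', ← hd]
  field_simp

end

end Literature.MathematicalPhysics.KineticTheory
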